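import Mathlib
import Summits.ValiantsHypothesis.ValiantsHypothesis.Theorems.ValuativeGCTValuativeFlipSeedHessian

/-!
# Explicit padded-permanent highest-weight vectors, IV: the Hessian seed is transcendental —
# the `D = 0` instance of `stub_seedRichness`, explicitly, for all `2 ≤ n ≤ m`

Wall-breaker axis k5 of crux `ValuativeGCT.ValuativeFlip` (stmt-ValiantsHypothesis-12624).
`stub_seedRichness` asks for `F : Fin (D+1) → OrbitCoordRing (paddedPerFormLex ℂ n m) m` with all `F i`
highest-weight vectors of one weight and `AlgebraicIndependent ℂ F`, `D ≥ n⁴/4`.  This file proves the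
shape of that statement with `D = 0` and an EXPLICIT `F`: the class of the lifted Hessian seed
(`…SeedHessian.lean`) is ALGEBRAICALLY INDEPENDENT (= transcendental over `ℂ`) in
`OrbitCoordRing (paddedPerFormLex ℂ n (n+j)) (n+j)`, for every `n ≥ 2` and every padding `j`
(`exists_algebraicIndependent_paddedPer_hessian`).  Certificate: along the LINE of collapsed permanents
`x_top^{n-1}·(t y) ∈ End·per_n` (`X_pow_mul_C_mul_X_mem_endOrbit_paddedPerFormLex`) the padded vector takes
the values `c · t²` with one `c ≠ 0` (top-pure evaluation `aeval_paddedForm_liftHWV_of_topPure`, degree `2`),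
and `t ↦ t²` is transcendental; the independence certificate `psl_algebraicIndependent_mk_of_eval` (k9)
concludes.  So the explicit-seed residual of the axis (AXIS note) is instantiated at `D = 0` in the stub's
own currency; `D ≥ 1` at a two-row weight is impossible twist-free (visibility law, AXIS note §3).

No definitions; sorry-free. [this seat; BIP 2019 §5; Mulmuley–Sohoni 2001 §4]
-/

set_option linter.dupNamespace false

namespace Summit.ValiantsHypothesis.ValiantsHypothesis.Theorems.ValuativeFlip

open MvPolynomial
open scoped BigOperators Matrix
open Literature.NumberTheory.DiophantineGeometry Literature.Computability.AlgebraicComplexity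
open Literature.Computability.Complexity (liftHWV paddedForm rowLift partitionWeightLex topMatIdx
  le_topMatIdx liftHWV_mem_highestWeightSpace)
open Literature.Barriers.ValiantsHypothesis (degIdxMap rename_mem_highestWeightSpace_coordRep)

noncomputable section

/-- `t ↦ t²` is transcendental: the one-element family `(X²)` in `ℂ[X]` (`MvPolynomial Unit ℂ`) is
algebraically independent. [folklore] -/
theorem algebraicIndependent_X_sq :
    AlgebraicIndependent ℂ (fun _ : Fin 1 => ((X () : MvPolynomial Unit ℂ) ^ 2)) := by
  rw [algebraicIndependent_unique_type_iff]
  have hX : Transcendental ℂ (X () : MvPolynomial Unit ℂ) := by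
    have h := MvPolynomial.algebraicIndependent_X Unit ℂ
    rw [algebraicIndependent_unique_type_iff] at h
    exact h
  exact hX.pow (by norm_num)

/-- A form `G` of degree `δ` at a scaled coefficient vector: `G(t • f) = t^δ · G(f)`. [folklore] -/
theorem aeval_formCoeff_smul_of_isHomogeneous {σ : Type*} [Fintype σ] [DecidableEq σ] {n δ : ℕ}
    {G : MvPolynomial (DegIdx σ n) ℂ} (hG : G.IsHomogeneous δ) (t : ℂ) (f : MvPolynomial σ ℂ) :
    aeval (formCoeff n (t • f)) G = t ^ δ * aeval (formCoeff n f) G := by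
  rw [formCoeff_smul]
  have h := algHom_apply_eq_pow_smul_of_isHomogeneous (aeval (t • formCoeff n f)) (aeval (formCoeff n f)) t
    (fun e => by rw [aeval_X, aeval_X, Pi.smul_apply]) hG
  rw [h, smul_eq_mul]

/-- **The lifted Hessian seed is transcendental — `stub_seedRichness` with `D = 0`, explicitly.**  For
`n ≥ 2`, every padding `j`, and `λ` with parts `{2(n+j)-2, 2}`: there is an (explicit) family
`F : Fin 1 → OrbitCoordRing (paddedPerFormLex ℂ n (n+j)) (n+j)` of highest-weight vectors of weight
`partitionWeightLex (n+j) λ` which is ALGEBRAICALLY INDEPENDENT over `ℂ` — namely the class of the lift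
`liftHWV n j G_n` of the transported Hessian source.  Along the line `x_top^{n-1}·(t·y)` of collapsed
permanents its values are `c·t²`, `c = (((n-1)+j)!/(n-1)!)² · (-(n-1)) ≠ 0`, and `t ↦ t²` is transcendental
(`algebraicIndependent_X_sq`, `psl_algebraicIndependent_mk_of_eval`). [this file] -/
theorem exists_algebraicIndependent_paddedPer_hessian (n j : ℕ) [NeZero n] [NeZero (n + j)] (hn : 2 ≤ n)
    (lam : Nat.Partition ((n + j) * 2)) (hlam : lam.parts = {2 * (n + j) - 2, 2}) :
    ∃ F : Fin 1 → OrbitCoordRing (paddedPerFormLex ℂ n (n + j)) (n + j),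
      (∀ i, F i ∈ highestWeightSpace (orbitCoordRep (paddedPerFormLex ℂ n (n + j)) (n + j))
        (partitionWeightLex (n + j) lam)) ∧
      AlgebraicIndependent ℂ F := by
  classical
  obtain ⟨ι, hι, hup, hι1, hι0⟩ := exists_topTwoEmb n hn
  -- the seed, its weight, its lift (as in `hasHighestWeight_paddedPer_hessian`)
  have hvec : (![(-2 : ℤ), -(2 * (n : ℤ) - 2)] : Fin 2 → ℤ) =
      ![-((2 : ℕ) : ℤ), -((2 * n - 2 : ℕ) : ℤ)] := by
    have h2n : 2 ≤ 2 * n := by omega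
    funext i
    fin_cases i
    · simp
    · simp [Nat.cast_sub h2n]
  let lam₂ : Nat.Partition (n * 2) :=
    ⟨{2 * n - 2, 2}, by
      intro i hi
      simp only [Multiset.insert_eq_cons, Multiset.mem_cons, Multiset.mem_singleton] at hi
      omega, by
      simp only [Multiset.insert_eq_cons, Multiset.sum_cons, Multiset.sum_singleton]
      omega⟩
  have hlam₂ : lam₂.parts = {2 * n - 2, 2} := rfl
  have hcard : lam₂.parts.card ≤ n * n := by
    rw [hlam₂]
    simp only [Multiset.insert_eq_cons, Multiset.card_cons, Multiset.card_singleton]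
    nlinarith
  set G : MvPolynomial (DegIdx (MatIdx n) n) ℂ :=
    rename (degIdxMap hι.injective) (hessianSource ℂ n) with hG_def
  have hG : G ∈ highestWeightSpace (coordRep (MatIdx n) ℂ n) (partitionWeightLex n lam₂) := by
    rw [partitionWeightLex_eq_extend_pair hι hι1 hι0 lam₂ (a := 2 * n - 2) (b := 2) (by omega) hlam₂,
      ← hvec]
    exact rename_mem_highestWeightSpace_coordRep hι hup (hessianSource_mem_highestWeightSpace hn)
  have hGδ : G.IsHomogeneous 2 :=
    (isHomogeneous_hessianSource n).rename_isHomogeneous (f := degIdxMap hι.injective)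
  have hlift := liftHWV_mem_highestWeightSpace lam₂ hcard j hG
  rw [partitionWeightLex_rowLift_pair lam₂ lam (a := 2 * n - 2) (b := 2) (d := 2) (by omega) hlam₂
    (by rw [hlam]; congr 1; omega)] at hlift
  have hclass := psl_mk_mem_highestWeightSpace (paddedPerFormLex ℂ n (n + j)) (n + j) _ hlift
  refine ⟨fun _ => Ideal.Quotient.mk (orbitVanishingIdeal (paddedPerFormLex ℂ n (n + j)) (n + j))
    (liftHWV n j G), fun _ => hclass, ?_⟩
  -- the certification line `x_top^{n-1} · (t · y)`, `y = ι 0`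
  have hy : ι 0 ≠ topMatIdx n := by
    rw [← hι1]
    exact fun h => absurd (hι.injective h) (by decide)
  set q : MvPolynomial (MatIdx n) ℂ := X (topMatIdx n) ^ (n - 1) * X (ι 0) with hq_def
  have hq : q.IsHomogeneous n := isHomogeneous_X_pow_mul_X n (ι 0)
  have hval : aeval (formCoeff n q) G = -((n : ℂ) - 1) := aeval_formCoeff_hessianSeed n hn hι hι1
  have hval0 : aeval (formCoeff n q) G ≠ 0 := by
    rw [hval, neg_ne_zero, sub_ne_zero]
    exact_mod_cast (show n ≠ 1 by omega)
  -- the constant `c = ((n-1+j)!/(n-1)!)² · G(q)`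
  set c : ℂ := ((((n - 1 + j).descFactorial j : ℕ) : ℂ)) ^ 2 * aeval (formCoeff n q) G with hc_def
  have hc : c ≠ 0 :=
    mul_ne_zero (pow_ne_zero _ (Nat.cast_ne_zero.mpr (descFactorial_add_pos (n - 1) j).ne')) hval0
  refine psl_algebraicIndependent_mk_of_eval (paddedPerFormLex ℂ n (n + j)) (n + j)
    (fun _ : Fin 1 => liftHWV n j G) (fun _ : Fin 1 => ((X () : MvPolynomial Unit ℂ) ^ 2))
    algebraicIndependent_X_sq (fun _ => c) (fun _ => hc) fun x => ?_
  -- the point of parameter `t = x ()`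
  set t : ℂ := x () with ht
  obtain ⟨B, hB⟩ := X_pow_mul_C_mul_X_mem_endOrbit_paddedPerFormLex n t (ι 0)
  obtain ⟨M, hM⟩ := psl_paddedForm_linSubst_per_mem_endOrbit n j B
  refine ⟨M, fun _ => ?_⟩
  have htq : (X (topMatIdx n) ^ (n - 1) * (C t * X (ι 0)) : MvPolynomial (MatIdx n) ℂ) = t • q := by
    rw [hq_def, smul_eq_C_mul]
    ring
  dsimp only at hB hM
  rw [hM, hB, htq]
  -- top-purity and homogeneity of `t • q`
  have hqr : ∀ e ∈ (t • q).support, e (topMatIdx n) = n - 1 := fun e he =>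
    apply_top_of_mem_support_X_pow_mul_X n hy e (support_smul he)
  have hqt : (t • q).IsHomogeneous n := by
    rw [smul_eq_C_mul]
    exact hq.C_mul t
  rw [aeval_paddedForm_liftHWV_of_topPure n j hGδ hqt hqr, aeval_formCoeff_smul_of_isHomogeneous hGδ t q]
  simp only [eval_pow, eval_X, hc_def]
  rw [← ht]
  ring

/-- **The same for all `2 ≤ n ≤ m`, in the crux's own weights** (`m = n + j`): an explicit, algebraically
independent (one-element) family of highest-weight vectors of weight `(Weight.dualOfPartition (m*m) λ).toMatIdx`,
`λ = (2m-2, 2) ⊢ 2m`, in `OrbitCoordRing (paddedPerFormLex ℂ n m) m` — `stub_seedRichness` at `D = 0`.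
[this file] -/
theorem exists_algebraicIndependent_paddedPer_hessian' {n m : ℕ} [NeZero n] [NeZero m] (hn : 2 ≤ n)
    (hnm : n ≤ m) (lam : Nat.Partition (m * 2)) (hlam : lam.parts = {2 * m - 2, 2}) :
    ∃ F : Fin 1 → OrbitCoordRing (paddedPerFormLex ℂ n m) m,
      (∀ i, F i ∈ highestWeightSpace (orbitCoordRep (paddedPerFormLex ℂ n m) m)
        ((Weight.dualOfPartition (m * m) lam).toMatIdx : Weight (MatIdx m))) ∧
      AlgebraicIndependent ℂ F := by
  obtain ⟨j, rfl⟩ := Nat.exists_eq_add_of_le hnm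
  exact exists_algebraicIndependent_paddedPer_hessian n j hn lam hlam

end

end Summit.ValiantsHypothesis.ValiantsHypothesis.Theorems.ValuativeFlip
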